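import Mathlib
import Summits.NavierStokesRegularity.NavierStokesRegularity.Theorems.EulerZoomLiouvillePowerGaugeEulerLiouvilleSpiralProfileEquationSlab
import HarnessLib

/-!
# Crux `EulerZoomLiouville.PowerGaugeEulerLiouville` (stmt-NavierStokesRegularity-19832), width sub-line `relative_equilibria`
# (ns-idea-11), R3a port recipe step P6, IV: the profile of a spiral pair is WEAKLY DIVERGENCE FREE

Route №10 `EulerZoomLiouville` (NavierStokesRegularity), crux E.  Seat ns-ezl-w2 g8 (`--supports stmt-19832 --as helper`).
The spiral twin of `ProfileEquation.profile_isWeaklyDivFree` (`…SelfSimilarProfileEquation`): for a distributional Euler pair on the slab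
`(−∞,0) × ℝ³` whose velocity is an origin-centred spiral `u(τ,x) = (−τ)^{γ−1} e^{(log(−τ))S} V(e^{−(log(−τ))S}((−τ)^{−γ}x))` (`S` skew,
`V ∈ L¹_loc`), the profile `V` is weakly divergence free: test the slab identity `∫∫⟪u, ∇θ⟫ = 0` with the scalar spiral composite
`θ(t,x) = χ(t) ϑ(e^{−(log(−t))S}((−t)^{−γ}x))` (`…SpiralProfileEquationTools.isSpaceTimeTestOn_spiralComp`); after the rotated change of variables
this is `(∫χ(−t)^{3γ−1}) ∫ Dϑ(V) = 0` for every `χ ∈ C_c^∞((−2,−1/2))` — the rotation drops out because `e^{−(log(−t))S} e^{(log(−t))S} = 1`.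

WHAT THIS IS NOT: not NS, not E, no stub closed — a brick (P6) of the `Sig.stub_spiralLocData` port; 19832 OPEN.  [folklore; ChaeTsai2013DSS p. 4]
-/

noncomputable section

set_option linter.dupNamespace false

open MeasureTheory Set Filter Topology Metric Function TopologicalSpace
open scoped ENNReal NNReal RealInnerProductSpace ContDiff

namespace Summit.NavierStokesRegularity.NavierStokesRegularity.Theorems.PowerGaugeEulerLiouville

open Literature.Analysis Literature.Analysis.FunctionSpaces Literature.Analysis.FluidPDE
open Summit.NavierStokesRegularity.NavierStokesRegularity.Theorems.CoriolisHead

namespace SpiralProfileEquation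

variable {S : EuclideanSpace ℝ (Fin 3) →L[ℝ] EuclideanSpace ℝ (Fin 3)}

/-- **The profile of an origin-centred spiral distributional Euler pair is weakly divergence free.**  Test the slab divergence-free
identity `∫∫⟪u, ∇θ⟫ = 0` with `θ(t,x) = χ(t) ϑ(e^{−(log(−t))S}((−t)^{−γ}x))`: pointwise `⟪u, ∇θ⟫ = χ(t)(−t)^{−1} Dϑ(z)(V z)`
(`z = e^{−(log(−t))S}((−t)^{−γ}x)`, `Q⁻¹Q = 1`), and the rotated Fubini lemma gives `(∫χ(−t)^{3γ−1}) ∫ Dϑ(V) = 0` for every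
`χ ∈ C_c^∞((−2,−1/2))`. [folklore; ChaeTsai2013DSS p. 4] -/
theorem spiral_profile_isWeaklyDivFree {γ : ℝ} (hS : ∀ x y : EuclideanSpace ℝ (Fin 3), ⟪S x, y⟫ = -⟪x, S y⟫)
    {u : ℝ → EuclideanSpace ℝ (Fin 3) → EuclideanSpace ℝ (Fin 3)} {p : ℝ → EuclideanSpace ℝ (Fin 3) → ℝ}
    (hsol : IsDistributionalNSSolutionOn (slab (EuclideanSpace ℝ (Fin 3)) (Iio 0) isOpen_Iio) 0 0 u p)
    {V : EuclideanSpace ℝ (Fin 3) → EuclideanSpace ℝ (Fin 3)}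
    (hu : ∀ τ : ℝ, τ < 0 → u τ = fun x => (-τ) ^ (γ - 1) • NormedSpace.exp ((Real.log (-τ)) • S)
      (V (NormedSpace.exp ((-Real.log (-τ)) • S) ((-τ) ^ (-γ) • x))))
    (hV : LocallyIntegrable V volume) :
    IsWeaklyDivFree V := by
  intro ϑ hϑ
  have hB := Spiral.inner_self_of_skew hS
  have hϑd : Differentiable ℝ ϑ := hϑ.contDiff.differentiable (by simp)
  have hDϑc : Continuous (fderiv ℝ ϑ) := hϑ.contDiff.continuous_fderiv (by simp)
  set Kϑ : Set (EuclideanSpace ℝ (Fin 3)) := tsupport ϑ with hKϑ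
  have hKϑc : IsCompact Kϑ := hϑ.hasCompactSupport
  obtain ⟨C₁, hC₁⟩ := hDϑc.bounded_above_of_compact_support (hϑ.hasCompactSupport.fderiv (𝕜 := ℝ))
  have hDϑ0 : ∀ y, y ∉ Kϑ → fderiv ℝ ϑ y = 0 := fun y hy => fderiv_of_notMem_tsupport ℝ hy
  -- the integrand `g = ⟪V, ∇ϑ⟫ = Dϑ(V)` is integrable
  set g : EuclideanSpace ℝ (Fin 3) → ℝ := fun y => ⟪V y, gradient ϑ y⟫ with hg
  have hgeq : ∀ y, g y = fderiv ℝ ϑ y (V y) := fun y => inner_gradient_eq_fderiv_apply y (V y)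
  have hVm : AEStronglyMeasurable V volume := hV.aestronglyMeasurable
  have hgi : Integrable g volume := by
    have e : g = fun y => fderiv ℝ ϑ y (V y) := funext hgeq
    rw [e]
    refine ProfileEnergy.integrable_of_abs_le_on hKϑc.measurableSet
      (ProfileEnergy.aestronglyMeasurable_clm_apply hDϑc.aestronglyMeasurable hVm)
      (hV.integrableOn_isCompact hKϑc).norm (C := C₁) (fun y _ => ?_) (fun y hy => by rw [hDϑ0 y hy]; simp)
    rw [abs_of_nonneg (norm_nonneg _)]
    exact (Real.norm_eq_abs _ ▸ (fderiv ℝ ϑ y).le_opNorm (V y)).trans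
      (mul_le_mul_of_nonneg_right (hC₁ y) (norm_nonneg _))
  -- the key identity for every `χ`
  have key : ∀ χ : ℝ → ℝ, ContDiff ℝ (⊤ : ℕ∞) χ → HasCompactSupport χ →
      tsupport χ ⊆ Ioo (-2 : ℝ) (-1 / 2) → (∫ t, χ t * (-t) ^ (3 * γ - 1)) * (∫ y, g y) = 0 := by
    intro χ hχ _ hχI
    have hb : (-1 / 2 : ℝ) < 0 := by norm_num
    have hχ0 : ∀ t, (-1 / 2 : ℝ) ≤ t → χ t = 0 := fun t ht =>
      image_eq_zero_of_notMem_tsupport fun h => (not_lt.2 ht) (hχI h).2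
    have hΘ := isSpaceTimeTestOn_spiralComp (γ := γ) hb hχ hχI hS hϑ
    have id0 := hsol.2.2.2.1 _ hΘ
    set α : ℝ → ℝ := fun t => χ t * (-t) ^ (-1 : ℝ) with hα
    have hαc : Continuous α := ProfileEquation.continuous_mul_neg_rpow hb hχ.continuous hχ0 (-1)
    have hαs : support α ⊆ Ioo (-2 : ℝ) (-1 / 2) := by
      intro t ht
      rw [mem_support] at ht
      have h : χ t ≠ 0 := fun h => ht (by simp only [hα, h, zero_mul])
      exact hχI (subset_tsupport _ (mem_support.2 h))
    obtain ⟨-, e0⟩ := integral_slab_mul_comp_spiral (γ := γ) hb hS hgi hαc hαs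
    have hslab : ((slab (EuclideanSpace ℝ (Fin 3)) (Iio 0) isOpen_Iio : Opens (ℝ × EuclideanSpace ℝ (Fin 3))) :
        Set (ℝ × EuclideanSpace ℝ (Fin 3))) = Iio (0 : ℝ) ×ˢ (univ : Set (EuclideanSpace ℝ (Fin 3))) :=
      coe_slab (X := EuclideanSpace ℝ (Fin 3)) (Iio 0) isOpen_Iio
    have h1 : ∫ z in Iio (0 : ℝ) ×ˢ (univ : Set (EuclideanSpace ℝ (Fin 3))),
        α z.1 * g (NormedSpace.exp ((-Real.log (-z.1)) • S) ((-z.1) ^ (-γ) • z.2)) = 0 := by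
      rw [← hslab]
      refine Eq.trans (setIntegral_congr_fun
        (slab (EuclideanSpace ℝ (Fin 3)) (Iio 0) isOpen_Iio).isOpen.measurableSet fun z hz => ?_) id0
      have ht : z.1 < 0 := by rw [hslab] at hz; exact hz.1
      have hs : 0 < -z.1 := neg_pos.2 ht
      rw [hu z.1 ht, inner_gradient_eq_fderiv_apply, fderiv_spiralComp_slice χ hϑd, hgeq]
      beta_reduce
      set w : EuclideanSpace ℝ (Fin 3) := NormedSpace.exp ((-Real.log (-z.1)) • S) ((-z.1) ^ (-γ) • z.2) with hw
      -- `Q⁻¹((−t)^{−γ} • (−t)^{γ−1} • Q V w) = ((−t)^{−γ}(−t)^{γ−1}) • V w`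
      have hQiu : NormedSpace.exp ((-Real.log (-z.1)) • S)
          ((-z.1) ^ (-γ) • ((-z.1) ^ (γ - 1) • NormedSpace.exp ((Real.log (-z.1)) • S) (V w))) =
          ((-z.1) ^ (-γ) * (-z.1) ^ (γ - 1)) • V w := by
        rw [map_smul, map_smul, Killing.expSkew_neg_apply_expSkew, smul_smul]
      rw [hQiu, map_smul]
      simp only [hα, smul_eq_mul]
      have e : (-z.1) ^ (-γ) * (-z.1) ^ (γ - 1) = (-z.1) ^ (-1 : ℝ) := by
        rw [← Real.rpow_add hs]; congr 1; ring
      linear_combination (-(χ z.1 * fderiv ℝ ϑ w (V w))) * e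
    have et : ∫ t, α t * (-t) ^ (3 * γ) = ∫ t, χ t * (-t) ^ (3 * γ - 1) := by
      refine integral_congr_ae (Eventually.of_forall fun t => ?_)
      by_cases ht : t < 0
      · simp only [hα]
        rw [mul_assoc, ← Real.rpow_add (neg_pos.2 ht)]; congr 2; ring
      · simp only [hα, hχ0 t (hb.le.trans (not_lt.1 ht)), zero_mul]
    rw [e0, et] at h1
    exact h1
  -- removing `χ` (verbatim from the untwisted proof)
  by_contra hne
  have hzero : ∀ χ : ℝ → ℝ, ContDiff ℝ (⊤ : ℕ∞) χ → HasCompactSupport χ →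
      tsupport χ ⊆ Ioo (-2 : ℝ) (-1 / 2) → ∫ t, χ t • (fun s : ℝ => (-s) ^ (3 * γ - 1)) t = 0 := by
    intro χ hχ hχc hχI
    have h := key χ hχ hχc hχI
    simp only [smul_eq_mul]
    rcases mul_eq_zero.1 h with h | h
    · exact h
    · exact absurd h hne
  have hloc : LocallyIntegrableOn (fun s : ℝ => (-s) ^ (3 * γ - 1)) (Ioo (-2 : ℝ) (-1 / 2)) volume := by
    refine ContinuousOn.locallyIntegrableOn (fun t ht => ?_) measurableSet_Ioo
    exact ((ProfileEquation.contDiffAt_neg_rpow (by linarith [ht.2]) (3 * γ - 1) (n := 0)).continuousAt).continuousWithinAt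
  have hae := IsOpen.ae_eq_zero_of_integral_contDiff_smul_eq_zero isOpen_Ioo hloc hzero
  have hpos : ∀ t ∈ Ioo (-2 : ℝ) (-1 / 2), (fun s : ℝ => (-s) ^ (3 * γ - 1)) t ≠ 0 := fun t ht =>
    (Real.rpow_pos_of_pos (by linarith [ht.2]) _).ne'
  have hnull : volume (Ioo (-2 : ℝ) (-1 / 2)) = 0 := by
    refine measure_eq_zero_iff_ae_notMem.2 ?_
    filter_upwards [hae] with t ht hmem
    exact hpos t hmem (ht hmem)
  rw [Real.volume_Ioo] at hnull
  have : ENNReal.ofReal (-1 / 2 - (-2 : ℝ)) ≠ 0 := by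
    rw [ENNReal.ofReal_ne_zero_iff]; norm_num
  exact this hnull

end SpiralProfileEquation

end Summit.NavierStokesRegularity.NavierStokesRegularity.Theorems.PowerGaugeEulerLiouville

end
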